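import Summits.QuantumFields.YangMills.Theses.MultiscaleHerbst
import Summits.QuantumFields.YangMills.Theorems.FibreConvexityTailTwoSidedTailLChernoffOnEvent

/-!
# Route `MultiscaleHerbst` — the support item `TwoSidedOfWindowHerbst` (stmt-QuantumFields-28166) PROVED: HERBST'S ARGUMENT + CHERNOFF —
# a window entropy (log-Sobolev-type) bound `WindowHerbstL` gives the two-sided-conditioned tail `FibreConvexityTail.TwoSidedTailL`

Cell `ym3-torus` (YM ladder rung R3 = continuum SU(2) Yang–Mills on the three-torus; NOT the Clay problem), width seat `ym-ust-19936-w2` gen 8 on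
the crux `HistoryTailL` (stmt-QuantumFields-19936).  The ideator line «multiscale-herbst» (`Cruxes/HistoryTailL/Lines/multiscale_herbst.lean`, route
`MultiscaleHerbst`, DRAFT) composes `HistoryTailL_of (hT : TowerTailL) := fibreConvexityTail_historyTailOfTwoSided_proof (stub_twoSidedOfWindowHerbst
(WindowHerbstL_of stub_deepWindowHerbst stub_shallowWindowHerbst)) hT`; THIS FILE discharges the glue stub `stub_twoSidedOfWindowHerbst` BY NAME
(`stub_twoSidedOfWindowHerbst : Theses.MultiscaleHerbst.TwoSidedOfWindowHerbst`, §3), so that line rests on its two ANALYTIC regime stubs and the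
residual `TowerTailL` only.

THE ARGUMENT.
* §1 **HERBST'S ARGUMENT, abstractly** (`herbst_mgf_le`): `ν` a finite measure of mass `m`, `X` bounded measurable, and for all `t ≥ 0` the ENTROPY
  bound `Ent_ν(e^{tX}) = ∫ e^{tX}·tX dν − (∫ e^{tX} dν)·log((∫ e^{tX} dν)/m) ≤ (σ²t²/2)·∫ e^{tX} dν` together with the CENTRING `∫ X dν ≤ a·m`
  give the Laplace bound `∫ e^{tX} dν ≤ m·exp(ta + σ²t²/2)` for all `t ≥ 0`.  Proof: `M(t) = mgf_ν(X)(t) > 0` is differentiable with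
  `M′(t) = ∫ X e^{tX}` (Mathlib `ProbabilityTheory.hasDerivAt_mgf`; every exponential moment of a bounded variable exists), `G(t) := log(M(t)/m)`
  has `G(0) = 0`, `G′ = M′/M`, and the entropy bound reads `t·G′(t) − G(t) ≤ σ²t²/2`, i.e. `φ(t) := G(t)/t − σ²t/2` has `φ′ ≤ 0` on `(0, ∞)`
  (`antitoneOn_of_deriv_nonpos`); since `G(t)/t → G′(0) = (∫X dν)/m ≤ a` as `t → 0⁺` (`HasDerivAt.tendsto_slope_zero_right`), `φ(t) ≤ a`, which is
  the claim.  ([Ledoux 1999/2001, «the Herbst argument»]; Boucheron–Lugosi–Massart, *Concentration Inequalities* (2013) §5.)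
* §2 **ONE PLAQUETTE** (`gibbsK_twoSidedEvent_le_of_window`): for the bounded observable `X = |Ū^{j}(∂a) − 1|/g_{K−j}` (`0 ≤ X ≤ 2/g`, `dist1 ≤ 2` on
  `SU(2)`) and a measurable window `W ⊇ twoSidedEvent` carrying the centring (`a = p(g_{K−j})/4`) and entropy clauses of `WindowHerbstL`, §1 applied to
  `ν = Gibbs_K|W` gives `mgf_{Gibbs_K|W}(X)(t) ≤ Gibbs_K(W)·exp(tp/4 + σ²t²/2)`; the tree's `FibreConvexityTail.subGaussianOnEvent_of_superset` moves it to
  the two-sided event and `FibreConvexityTail.stub_chernoffOnEvent` (Markov at `t = 3p/(4σ²)`) gives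
  `Gibbs_K(twoSidedEvent) ≤ Gibbs_K(W)·β^0·exp(−(9/(32σ²))·p²) ≤ 1·β^0·exp(−(9/(32σ²))·p²)`.
* §3 the quantifier plumbing: `twoSidedOfWindowHerbst_proof : TwoSidedOfWindowHerbst` (`C = 1`, `A = 0`, `c = 9/(32σ²)`; `bmin`, `γ₁` pass
  through) and the stub BY ITS EXACT NAME `stub_twoSidedOfWindowHerbst`.

WHAT THIS IS NOT.  `WindowHerbstL` (the K- and height-uniform window entropy bound — the located, unprinted content) and the residual `TowerTailL` are
HYPOTHESES of the line and stay open; nothing here proves the crux `HistoryTailL`, the rung R3 (`YM3TorusSU2`), d = 4, a continuum limit or a mass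
gap.  YM₃ on T³ is rung R3 of the programme, NOT the Clay problem.

References: M. Ledoux, *Concentration of measure and logarithmic Sobolev inequalities*, Sém. Probab. XXXIII, LNM 1709 (1999) 120–216 (§2.3, the
Herbst argument); S. Boucheron, G. Lugosi, P. Massart, *Concentration Inequalities* (OUP 2013), §5.1–5.2; D. Bakry, I. Gentil, M. Ledoux, *Analysis
and Geometry of Markov Diffusion Operators* (Springer 2014), Prop. 5.4.1; T. Bałaban, CMP **102** (1985) 255–275 [Balaban1985UV3] ((3) p.256,
(7) p.257: the thresholds `θ(i) = g_i·p(g_i)`).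
-/

noncomputable section

open MeasureTheory ProbabilityTheory Real Filter Set
open scoped Topology
open Literature.MathematicalPhysics.QuantumFieldTheory.Balaban1983to89
open Literature.MathematicalPhysics.QuantumFieldTheory.Balaban1983to89.T3ContinuumYM3Torus
open Literature.MathematicalPhysics.QuantumFieldTheory.Balaban1983to89.T3UnitScaleTilt
open Literature.MathematicalPhysics.QuantumFieldTheory.Balaban1983to89.T3UnitLawDensityEML (ℰp measurableE_ℰp)
open Literature.MathematicalPhysics.QuantumFieldTheory.Balaban1983to89.T3ThresholdSmallness (sqrt_coupling_pos_le)
open Literature.MathematicalPhysics.QuantumFieldTheory.Balaban1983to89.T4PairDerivBridge (dist1_le_two_specialUnitaryGroup)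
open Summit.QuantumFields.YangMills.Theorems.FibreConvexityTail (twoSidedEvent SubGaussianOnEvent twoSidedTailL_iff
  measurable_dist1_plaqHol_iter subGaussianOnEvent_of_superset stub_chernoffOnEvent)

namespace Summit.QuantumFields.YangMills.Theorems.MultiscaleHerbstTwoSidedOfWindowHerbst

/-! ## §1 Herbst's argument for a bounded observable under a finite measure -/

section Herbst

variable {Ω : Type*} [MeasurableSpace Ω]

/-- Every exponential moment of a bounded measurable observable under a finite measure exists. [folklore] -/
theorem integrable_exp_mul_of_abs_le (ν : Measure Ω) [IsFiniteMeasure ν] {X : Ω → ℝ} (hXm : Measurable X) {B : ℝ}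
    (hX : ∀ ω, |X ω| ≤ B) (t : ℝ) : Integrable (fun ω => Real.exp (t * X ω)) ν := by
  refine (integrable_const (Real.exp (|t| * B))).mono' ((measurable_exp.comp (hXm.const_mul t)).aestronglyMeasurable)
    (ae_of_all _ fun ω => ?_)
  rw [Real.norm_eq_abs, abs_of_pos (Real.exp_pos _)]
  refine Real.exp_le_exp.mpr ?_
  calc t * X ω ≤ |t * X ω| := le_abs_self _
    _ = |t| * |X ω| := abs_mul t (X ω)
    _ ≤ |t| * B := mul_le_mul_of_nonneg_left (hX ω) (abs_nonneg t)

/-- For a bounded measurable observable under a finite measure every real parameter is interior to the domain of the moment generating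
function (`ProbabilityTheory.integrableExpSet = univ`). [folklore] -/
theorem mem_interior_integrableExpSet_of_abs_le (ν : Measure Ω) [IsFiniteMeasure ν] {X : Ω → ℝ} (hXm : Measurable X) {B : ℝ}
    (hX : ∀ ω, |X ω| ≤ B) (t : ℝ) : t ∈ interior (integrableExpSet X ν) := by
  have huniv : integrableExpSet X ν = Set.univ :=
    Set.eq_univ_of_forall fun s => integrable_exp_mul_of_abs_le ν hXm hX s
  rw [huniv, interior_univ]
  exact Set.mem_univ t

/-- **HERBST'S ARGUMENT.**  Let `ν` be a finite measure of total mass `m`, `X` a bounded measurable observable, `a, σ ∈ ℝ`.  If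
(centring) `∫ X dν ≤ a·m` and (entropy, for every `t ≥ 0`) `∫ e^{tX}·(tX) dν − (∫ e^{tX} dν)·log((∫ e^{tX} dν)/m) ≤ (σ²t²/2)·∫ e^{tX} dν`, then
for every `t ≥ 0` the Laplace transform obeys `∫ e^{tX} dν ≤ m·exp(t·a + σ²t²/2)`.  (Differentiate `φ(t) = t⁻¹·log(mgf(t)/m) − σ²t/2`: the entropy
bound is `φ′ ≤ 0`, and `φ(0⁺) = (∫ X dν)/m ≤ a`.)  The junk case `ν = 0` holds with both sides `0`. [cite: BoucheronLugosiMassart2013, §5.2 (Herbst's argument); BakryGentilLedoux2014, Prop. 5.4.1] -/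
theorem herbst_mgf_le (ν : Measure Ω) [IsFiniteMeasure ν] {X : Ω → ℝ} (hXm : Measurable X) {B : ℝ} (hX : ∀ ω, |X ω| ≤ B)
    {m a σ : ℝ} (hm : ν.real Set.univ = m)
    (hcen : ∫ ω, X ω ∂ν ≤ a * m)
    (hent : ∀ t : ℝ, 0 ≤ t →
      (∫ ω, Real.exp (t * X ω) * (t * X ω) ∂ν) -
          (∫ ω, Real.exp (t * X ω) ∂ν) * Real.log ((∫ ω, Real.exp (t * X ω) ∂ν) / m) ≤
        σ ^ 2 * t ^ 2 / 2 * ∫ ω, Real.exp (t * X ω) ∂ν) :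
    ∀ t : ℝ, 0 ≤ t → mgf X ν t ≤ m * Real.exp (t * a + σ ^ 2 * t ^ 2 / 2) := by
  intro t ht
  -- junk case `ν = 0`
  by_cases hν : ν = 0
  · subst hν
    have hm0 : m = 0 := by rw [← hm]; simp
    rw [mgf_zero_measure, hm0, Pi.zero_apply, zero_mul]
  -- the mass is positive
  have hm_pos : 0 < m := by
    rw [← hm, measureReal_def]
    exact ENNReal.toReal_pos (Measure.measure_univ_ne_zero.mpr hν) (measure_ne_top ν _)
  -- the case `t = 0`
  rcases ht.eq_or_lt with rfl | htpos
  · rw [mgf_zero', hm]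
    simp
  -- the moment generating function `M`, positive and differentiable everywhere
  have hint : ∀ s : ℝ, Integrable (fun ω => Real.exp (s * X ω)) ν := integrable_exp_mul_of_abs_le ν hXm hX
  have hmem : ∀ s : ℝ, s ∈ interior (integrableExpSet X ν) := mem_interior_integrableExpSet_of_abs_le ν hXm hX
  have hMpos : ∀ s : ℝ, 0 < mgf X ν s := fun s => mgf_pos' hν (hint s)
  have hMderiv : ∀ s : ℝ, HasDerivAt (mgf X ν) (∫ ω, X ω * Real.exp (s * X ω) ∂ν) s := fun s => hasDerivAt_mgf (hmem s)
  have hM0 : mgf X ν 0 = m := by rw [mgf_zero', hm]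
  -- `G(s) = log (M(s)/m)`, `G(0) = 0`, `G' = M'/M`
  set G : ℝ → ℝ := fun s => Real.log (mgf X ν s / m) with hGdef
  have hGderiv : ∀ s : ℝ, HasDerivAt G ((∫ ω, X ω * Real.exp (s * X ω) ∂ν) / mgf X ν s) s := by
    intro s
    have h1 : HasDerivAt (fun s => mgf X ν s / m) ((∫ ω, X ω * Real.exp (s * X ω) ∂ν) / m) s := (hMderiv s).div_const m
    have h2 := h1.log (div_pos (hMpos s) hm_pos).ne'
    rw [div_div_div_cancel_right₀ hm_pos.ne'] at h2
    exact h2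
  have hG0 : G 0 = 0 := by
    show Real.log (mgf X ν 0 / m) = 0
    rw [hM0, div_self hm_pos.ne', Real.log_one]
  -- the entropy hypothesis in terms of `M` and `G`: `s·M'(s) − M(s)·G(s) ≤ (σ²s²/2)·M(s)`
  have hent' : ∀ s : ℝ, 0 ≤ s →
      s * (∫ ω, X ω * Real.exp (s * X ω) ∂ν) - mgf X ν s * G s ≤ σ ^ 2 * s ^ 2 / 2 * mgf X ν s := by
    intro s hs
    have h := hent s hs
    have hlin : ∫ ω, Real.exp (s * X ω) * (s * X ω) ∂ν = s * ∫ ω, X ω * Real.exp (s * X ω) ∂ν := by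
      rw [← integral_const_mul]
      refine integral_congr_ae (ae_of_all _ fun ω => ?_)
      ring
    rw [hlin] at h
    exact h
  -- `φ(s) = G(s)/s − σ²s/2` is antitone on `(0, ∞)`
  set φ : ℝ → ℝ := fun s => G s / s - σ ^ 2 * s / 2 with hφdef
  have hφderiv : ∀ s : ℝ, 0 < s → HasDerivAt φ
      ((((∫ ω, X ω * Real.exp (s * X ω) ∂ν) / mgf X ν s * s - G s * 1) / s ^ 2) - σ ^ 2 / 2) s := by
    intro s hs
    have h1 := (hGderiv s).div (hasDerivAt_id s) hs.ne'
    have h2 : HasDerivAt (fun s : ℝ => σ ^ 2 * s / 2) (σ ^ 2 / 2) s := by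
      have := ((hasDerivAt_id s).const_mul (σ ^ 2)).div_const 2
      simpa using this
    exact h1.sub h2
  have hφ'le : ∀ s : ℝ, 0 < s → deriv φ s ≤ 0 := by
    intro s hs
    rw [(hφderiv s hs).deriv]
    have hM := hMpos s
    have h := hent' s hs.le
    have hs2 : 0 < s ^ 2 := by positivity
    -- divide the entropy bound by `M(s) > 0`
    have key : (∫ ω, X ω * Real.exp (s * X ω) ∂ν) / mgf X ν s * s - G s * 1 ≤ σ ^ 2 / 2 * s ^ 2 := by
      rw [mul_one, div_mul_eq_mul_div, sub_le_iff_le_add, div_le_iff₀ hM]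
      nlinarith [h]
    have : ((∫ ω, X ω * Real.exp (s * X ω) ∂ν) / mgf X ν s * s - G s * 1) / s ^ 2 ≤ σ ^ 2 / 2 := by
      rw [div_le_iff₀ hs2]
      exact key
    linarith
  have hcont : ContinuousOn φ (Set.Ioi 0) := fun s hs => (hφderiv s hs).continuousAt.continuousWithinAt
  have hdiff : DifferentiableOn ℝ φ (interior (Set.Ioi 0)) := by
    rw [interior_Ioi]
    exact fun s hs => (hφderiv s hs).differentiableAt.differentiableWithinAt
  have hanti : AntitoneOn φ (Set.Ioi 0) :=
    antitoneOn_of_deriv_nonpos (convex_Ioi 0) hcont hdiff (by rw [interior_Ioi]; exact hφ'le)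
  -- the limit at `0⁺`: `G(s)/s → G'(0) = (∫ X dν)/m`
  have hG'0 : HasDerivAt G ((∫ ω, X ω ∂ν) / m) 0 := by
    have h := hGderiv 0
    simp only [zero_mul, Real.exp_zero, mul_one] at h
    rw [hM0] at h
    exact h
  have hslope : Tendsto (fun s : ℝ => G s / s) (𝓝[>] 0) (𝓝 ((∫ ω, X ω ∂ν) / m)) := by
    have h := hG'0.tendsto_slope_zero_right
    refine h.congr' (eventually_nhdsWithin_of_forall fun s _ => ?_)
    simp only [zero_add, hG0, sub_zero, smul_eq_mul, div_eq_inv_mul]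
  have hlin0 : Tendsto (fun s : ℝ => σ ^ 2 * s / 2) (𝓝[>] 0) (𝓝 (σ ^ 2 * 0 / 2)) := by
    refine tendsto_nhdsWithin_of_tendsto_nhds ?_
    exact ((continuous_const.mul continuous_id).div_const 2).tendsto 0
  have hφlim : Tendsto φ (𝓝[>] 0) (𝓝 ((∫ ω, X ω ∂ν) / m - σ ^ 2 * 0 / 2)) := hslope.sub hlin0
  -- `φ(t) ≤ φ(0⁺) ≤ a`
  have hφt : φ t ≤ (∫ ω, X ω ∂ν) / m := by
    have hev : ∀ᶠ s in 𝓝[>] (0 : ℝ), φ t ≤ φ s := by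
      filter_upwards [Ioo_mem_nhdsGT htpos] with s hs
      exact hanti hs.1 htpos hs.2.le
    have h := ge_of_tendsto hφlim hev
    simpa using h
  have hcen' : (∫ ω, X ω ∂ν) / m ≤ a := by
    rw [div_le_iff₀ hm_pos]
    exact hcen
  have hGt : G t ≤ t * a + σ ^ 2 * t ^ 2 / 2 := by
    have h1 : G t / t - σ ^ 2 * t / 2 ≤ a := hφt.trans hcen'
    rw [sub_le_iff_le_add, div_le_iff₀ htpos] at h1
    nlinarith [h1]
  -- exponentiate
  have hexp : mgf X ν t / m ≤ Real.exp (t * a + σ ^ 2 * t ^ 2 / 2) := by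
    rw [← Real.exp_log (div_pos (hMpos t) hm_pos)]
    exact Real.exp_le_exp.mpr hGt
  rw [div_le_iff₀ hm_pos] at hexp
  linarith [hexp]

end Herbst

/-! ## §2 One plaquette: the window data of `WindowHerbstL` give the two-sided tail -/

/-- **ONE PLAQUETTE, ONE WINDOW.**  For a family `F`, `γ > 0`, `b₀ > 0`, cut-off `K`, height `j`, plaquette `a` of `T^{(j)}` and `σ > 0`: a measurable
window `W ⊇ twoSidedEvent` on which the centring clause `∫_W X ≤ (p/4)·Gibbs_K(W)` and the entropy clause of `WindowHerbstL` hold for the normalised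
deviation `X = |Ū^{j}(∂a) − 1|/g_{K−j}` gives `Gibbs_K(twoSidedEvent F γ b₀ p₀ K j a) ≤ 1·β_{K−j}^0·exp(−(9/(32σ²))·p(g_{K−j})²)` — Herbst (§1) on
`Gibbs_K|W`, the tree's `subGaussianOnEvent_of_superset`, and `stub_chernoffOnEvent`; `Gibbs_K(W) ≤ 1`. [cite: Balaban1985UV3, (7) p.257] -/
theorem gibbsK_twoSidedEvent_le_of_window (F : T3Family) {γ b₀ : ℝ} (p₀ : ℝ) (hγ : 0 < γ) (hb₀ : 0 < b₀) (K j : ℕ)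
    (a : Plaq (F.P K) j) {σ : ℝ} (hσ : 0 < σ)
    {W : Set (GaugeField (F.P K) 0 (Matrix.specialUnitaryGroup (Fin 2) ℂ))}
    (hWsub : twoSidedEvent F γ b₀ p₀ K j a ⊆ W)
    (hcen : ∫ U in W, GaugeGroup.dist1 (GaugeField.plaqHol
        (Averaging.iter (fun i' => BlockAveraging.blockAvg (P := F.P K) (j := i') ℰp) j U) a) /
          Real.sqrt (γ * ((F.L : ℝ)⁻¹) ^ (K - j)) ∂(gibbsK F ℰp γ K) ≤
      B10.pFun b₀ p₀ (Real.sqrt (γ * ((F.L : ℝ)⁻¹) ^ (K - j))) / 4 * (gibbsK F ℰp γ K).real W)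
    (hent : ∀ (t : ℝ), 0 ≤ t →
      (∫ U in W, Real.exp (t * (GaugeGroup.dist1 (GaugeField.plaqHol
          (Averaging.iter (fun i' => BlockAveraging.blockAvg (P := F.P K) (j := i') ℰp) j U) a) /
            Real.sqrt (γ * ((F.L : ℝ)⁻¹) ^ (K - j)))) *
          (t * (GaugeGroup.dist1 (GaugeField.plaqHol
            (Averaging.iter (fun i' => BlockAveraging.blockAvg (P := F.P K) (j := i') ℰp) j U) a) /
              Real.sqrt (γ * ((F.L : ℝ)⁻¹) ^ (K - j)))) ∂(gibbsK F ℰp γ K)) -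
        (∫ U in W, Real.exp (t * (GaugeGroup.dist1 (GaugeField.plaqHol
          (Averaging.iter (fun i' => BlockAveraging.blockAvg (P := F.P K) (j := i') ℰp) j U) a) /
            Real.sqrt (γ * ((F.L : ℝ)⁻¹) ^ (K - j)))) ∂(gibbsK F ℰp γ K)) *
          Real.log ((∫ U in W, Real.exp (t * (GaugeGroup.dist1 (GaugeField.plaqHol
            (Averaging.iter (fun i' => BlockAveraging.blockAvg (P := F.P K) (j := i') ℰp) j U) a) /
              Real.sqrt (γ * ((F.L : ℝ)⁻¹) ^ (K - j)))) ∂(gibbsK F ℰp γ K)) / (gibbsK F ℰp γ K).real W) ≤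
      σ ^ 2 * t ^ 2 / 2 * ∫ U in W, Real.exp (t * (GaugeGroup.dist1 (GaugeField.plaqHol
          (Averaging.iter (fun i' => BlockAveraging.blockAvg (P := F.P K) (j := i') ℰp) j U) a) /
            Real.sqrt (γ * ((F.L : ℝ)⁻¹) ^ (K - j)))) ∂(gibbsK F ℰp γ K)) :
    (gibbsK F ℰp γ K).real (twoSidedEvent F γ b₀ p₀ K j a) ≤
      1 * (F.scheme ℰp γ).β (K - j) ^ (0 : ℕ) *
        Real.exp (-(9 / (32 * σ ^ 2) * B10.pFun b₀ p₀ (Real.sqrt (γ * ((F.L : ℝ)⁻¹) ^ (K - j))) ^ 2)) := by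
  haveI := isProbabilityMeasure_gibbsK F ℰp hγ.le K
  have hg0 : 0 < Real.sqrt (γ * ((F.L : ℝ)⁻¹) ^ (K - j)) := (sqrt_coupling_pos_le F.hL.2.le hγ (K - j)).1
  -- the observable is bounded: `0 ≤ X ≤ 2/g`
  have hXm : Measurable fun U : GaugeField (F.P K) 0 (Matrix.specialUnitaryGroup (Fin 2) ℂ) =>
      GaugeGroup.dist1 (GaugeField.plaqHol
        (Averaging.iter (fun i' => BlockAveraging.blockAvg (P := F.P K) (j := i') ℰp) j U) a) /
          Real.sqrt (γ * ((F.L : ℝ)⁻¹) ^ (K - j)) :=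
    (measurable_dist1_plaqHol_iter F K j a).div_const _
  have hXbd : ∀ U : GaugeField (F.P K) 0 (Matrix.specialUnitaryGroup (Fin 2) ℂ),
      |GaugeGroup.dist1 (GaugeField.plaqHol
        (Averaging.iter (fun i' => BlockAveraging.blockAvg (P := F.P K) (j := i') ℰp) j U) a) /
          Real.sqrt (γ * ((F.L : ℝ)⁻¹) ^ (K - j))| ≤ 2 / Real.sqrt (γ * ((F.L : ℝ)⁻¹) ^ (K - j)) := by
    intro U
    rw [abs_of_nonneg (div_nonneg (GaugeGroup.dist1_nonneg _) hg0.le)]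
    exact div_le_div_of_nonneg_right (dist1_le_two_specialUnitaryGroup _) hg0.le
  -- Herbst on `Gibbs_K|W`
  have hmass : ((gibbsK F ℰp γ K).restrict W).real Set.univ = (gibbsK F ℰp γ K).real W := measureReal_restrict_apply_univ W
  have hmgf := herbst_mgf_le ((gibbsK F ℰp γ K).restrict W) hXm hXbd hmass hcen hent
  -- move to the two-sided event and apply Chernoff on the event
  have hM0 : 0 ≤ (gibbsK F ℰp γ K).real W := measureReal_nonneg
  have hM1 : (gibbsK F ℰp γ K).real W ≤ 1 := measureReal_le_one
  have hsub : SubGaussianOnEvent F γ b₀ p₀ K j a ((gibbsK F ℰp γ K).real W) σ := by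
    refine subGaussianOnEvent_of_superset F hγ b₀ p₀ K j a hWsub fun t ht => ?_
    have h := hmgf t ht
    rwa [show t * (B10.pFun b₀ p₀ (Real.sqrt (γ * ((F.L : ℝ)⁻¹) ^ (K - j))) / 4) + σ ^ 2 * t ^ 2 / 2 =
      t * (B10.pFun b₀ p₀ (Real.sqrt (γ * ((F.L : ℝ)⁻¹) ^ (K - j))) / 4) + σ ^ 2 * t ^ 2 / 2 from rfl]
  have hch := stub_chernoffOnEvent F γ b₀ p₀ hγ hb₀ K j a ((gibbsK F ℰp γ K).real W) σ hM0 hσ hsub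
  refine hch.trans ?_
  have hnn : 0 ≤ (F.scheme ℰp γ).β (K - j) ^ (0 : ℕ) *
      Real.exp (-(9 / (32 * σ ^ 2) * B10.pFun b₀ p₀ (Real.sqrt (γ * ((F.L : ℝ)⁻¹) ^ (K - j))) ^ 2)) := by positivity
  calc (gibbsK F ℰp γ K).real W * (F.scheme ℰp γ).β (K - j) ^ (0 : ℕ) *
        Real.exp (-(9 / (32 * σ ^ 2) * B10.pFun b₀ p₀ (Real.sqrt (γ * ((F.L : ℝ)⁻¹) ^ (K - j))) ^ 2))
      = (gibbsK F ℰp γ K).real W * ((F.scheme ℰp γ).β (K - j) ^ (0 : ℕ) *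
        Real.exp (-(9 / (32 * σ ^ 2) * B10.pFun b₀ p₀ (Real.sqrt (γ * ((F.L : ℝ)⁻¹) ^ (K - j))) ^ 2))) := by ring
    _ ≤ 1 * ((F.scheme ℰp γ).β (K - j) ^ (0 : ℕ) *
        Real.exp (-(9 / (32 * σ ^ 2) * B10.pFun b₀ p₀ (Real.sqrt (γ * ((F.L : ℝ)⁻¹) ^ (K - j))) ^ 2))) :=
        mul_le_mul_of_nonneg_right hM1 hnn
    _ = 1 * (F.scheme ℰp γ).β (K - j) ^ (0 : ℕ) *
        Real.exp (-(9 / (32 * σ ^ 2) * B10.pFun b₀ p₀ (Real.sqrt (γ * ((F.L : ℝ)⁻¹) ^ (K - j))) ^ 2)) := by ring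

/-! ## §3 The support item `TwoSidedOfWindowHerbst` (stmt-QuantumFields-28166) BY NAME, and the line's stub by its exact name -/

/-- **`TwoSidedOfWindowHerbst` (stmt-QuantumFields-28166): `WindowHerbstL → FibreConvexityTail.TwoSidedTailL`** — Herbst's argument + Chernoff,
per plaquette (§2), with `C = 1`, `A = 0`, `c = 9/(32σ²)`; the thresholds `bmin` and `γ₁ ≤ 1` of `WindowHerbstL` pass through unchanged.
CONDITIONAL: `WindowHerbstL` is NOT proved here. [cite: BoucheronLugosiMassart2013, §5.2; Balaban1985UV3, (7) p.257] -/
theorem twoSidedOfWindowHerbst_proof : Summit.QuantumFields.YangMills.Theses.MultiscaleHerbst.TwoSidedOfWindowHerbst := by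
  unfold Summit.QuantumFields.YangMills.Theses.MultiscaleHerbst.TwoSidedOfWindowHerbst
  intro hW
  rw [twoSidedTailL_iff]
  intro L
  obtain ⟨bmin, H⟩ := hW L
  refine ⟨bmin, fun b₀ p₀ hb hb₀ hp₀ => ?_⟩
  obtain ⟨γ₁, hγ₁, hγ₁1, G⟩ := H b₀ p₀ hb hb₀ hp₀
  refine ⟨γ₁, hγ₁, hγ₁1, fun F γ hFL hγ hγle => ?_⟩
  obtain ⟨σ, hσ, S⟩ := G F γ hFL hγ hγle
  refine ⟨1, 0, 9 / (32 * σ ^ 2), zero_le_one, by positivity, fun K j hj hjK a => ?_⟩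
  obtain ⟨W, -, hWsub, hcen, hent⟩ := S K j hj hjK a
  refine gibbsK_twoSidedEvent_le_of_window F p₀ hγ hb₀ K j a hσ (fun U hU => hWsub ⟨hU.1.2, hU.2⟩) hcen hent

/-- **THE REGISTERED STUB `stub_twoSidedOfWindowHerbst` OF LINE «multiscale-herbst» (field skeleton `Cruxes/HistoryTailL/Lines/multiscale_herbst.lean`)
BY ITS EXACT NAME AND TYPE** — so that line's `HistoryTailL_of (hT : TowerTailL)` rests on its two analytic regime stubs and the residual only.
CONDITIONAL on those, which are NOT proved here. [cite: BoucheronLugosiMassart2013, §5.2] -/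
theorem stub_twoSidedOfWindowHerbst : Summit.QuantumFields.YangMills.Theses.MultiscaleHerbst.TwoSidedOfWindowHerbst :=
  twoSidedOfWindowHerbst_proof

end Summit.QuantumFields.YangMills.Theorems.MultiscaleHerbstTwoSidedOfWindowHerbst

end
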